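import Literature.Geometry.Riemannian.WassersteinW1Complete
import Literature.Geometry.Riemannian.MetricFlowPhiLipschitz
import Mathlib.MeasureTheory.Measure.Tight
import HarnessLib

/-!
# Subconvergence of pushed conjugate heat kernels (Bamler 2023, §7.3, Claim in the proof of the
# Lemma on subconvergence over finitely many times; arXiv v1 Claim 162): auxiliary estimates

R. Bamler, *Compactness theory of the space of super Ricci flows*, Invent. Math. 233 (2023), §7.3,
Claim (arXiv v1 Claim 162) in the proof of the Lemma (arXiv v1 Lemma 161): *"Let
`1 ≤ l ≤ k ≤ N` and `x^∞ ∈ X^∞_{t_k}`. Then, after passing to a subsequence, there is a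
probability measure `ν^∞_{x^∞;t_l} ∈ 𝒫(X^∞_{t_l})` such that for any sequence `xⁱ ∈ 𝒳ⁱ_{t_k}`
with `φⁱ_{t_k}(xⁱ) → φ^∞_{t_k}(x^∞)` we have
`(φⁱ_{t_l})_* νⁱ_{xⁱ;t_l} → (φ^∞_{t_l})_* ν^∞_{x^∞;t_l}` in `W₁`."* Its proof: *"it suffices to
show that the sequence of probability measures `(φⁱ_{t_l})_* νⁱ_{xⁱ;t_l}` on `Z_{t_l}` is tight.
So fix some `ε > 0`. By Lemma 2.4 (e) it suffices to show that there is a compact subset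
`K_ε ⊂ Z_{t_l}` such that for large `i`, `((φⁱ_{t_l})_* νⁱ_{xⁱ;t_l})(Z_{t_l} ∖ B(K_ε, ε)) ≤ ε`.
… So if for some large `i` we had `νⁱ_{xⁱ;t_l}(𝒳ⁱ_{t_l} ∖ K_{i,ε}) > ε`, then by Definition 3.2
(6), we would have `νⁱ_{·;t_l}(𝒳ⁱ_{t_l} ∖ K_{i,ε}) ≥ Φ(Φ⁻¹(ε) − D (t_k − t_l)^{-1/2})` on
`B(xⁱ, D)`, which would imply `μⁱ_{t_l}(𝒳ⁱ_{t_l} ∖ K_{i,ε}) =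
∫ νⁱ_{y;t_l}(𝒳ⁱ_{t_l} ∖ K_{i,ε}) dμⁱ_{t_k}(y) ≥ ½ Φ(Φ⁻¹(ε) − D (t_k − t_l)^{-1/2})"*, and
§2.1, Lemma 2.4 (e): *"A sequence `μ_i ∈ 𝒫(X)` is tight if and only if for any `ε > 0` there is
a compact subset `K'_ε ⊂ X` such that `μ_i(X ∖ B(K'_ε, ε)) ≤ ε` for large `i`."*

This file proves the self-contained estimates behind this argument, in the tree's vocabulary
(`variance` from `MetricFlowConcentration.lean`, `MetricFlow.Phi`, `MetricFlow.PhiInv`, Mathlib's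
`IsTightMeasureSet`, `Metric.thickening ε K = B(K, ε)`):

* `isTightMeasureSet_range_of_forall_eventually_thickening` — **Lemma 2.4 (e)** (the nontrivial
  direction) for finite measures on a complete separable metric space: if for every `η > 0` some
  compact `K` has `α_n(X ∖ B(K, η)) ≤ η` for all large `n`, then `{α_n}` is tight (finitely many
  measures are tight, so "large `n`" becomes "all `n`"; then `⋂_m B̄(K_m, η_m)` with `Σ_m η_m ≤ ε`
  is compact and loses mass `≤ ε`);
* `measure_le_of_gradient_property` — the **key step**: for a probability kernel `κ` from `X_k`
  to `X_l` with the gradient property at `T = 0` (for every measurable `v : X_l → [0, 1]`,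
  `x ↦ ∫ v dκ_x` is constant or `Φ ∘ f` with `f` `L`-Lipschitz) and `μ_l = ∫ κ_x dμ_k(x)`: if
  `κ_{x₀}(S) > ε` and `μ_k(B(x₀, D)) ≥ p`, then `μ_l(S) ≥ min(ε, Φ(Φ⁻¹(ε) − L D) p)`;
* `lintegral_edist_sq_le_of_variance_le`, `variance_map_le` — second moments from variances:
  `∫ d(z₀, ·)² dα ≤ 4R² + 4W` if `Var(α) ≤ W` and `α(B) ≥ ½` for some `B ⊆ B̄(z₀, R)`, and
  `Var(φ_* μ) ≤ Var(μ)` for an isometric embedding `φ`.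

Everything is proved; no definitions, no named facts.

## References

* R. H. Bamler, *Compactness theory of the space of super Ricci flows*, Invent. Math. 233 (2023),
  1121–1277 (arXiv:2008.09298), §2.1, Lemma 2.4 (e); §3.1, Definition 3.2 (6) (gradient
  property); §7.3, Claim (arXiv v1 Claim 162) in the proof of the Lemma (arXiv v1 Lemma 161).
  [Bamler2023]
-/

noncomputable section

open Set MeasureTheory Filter TopologicalSpace Function Metric
open scoped Topology ENNReal NNReal

namespace Literature.Geometry.Riemannian

/-! ### Bamler's Lemma 2.4 (e): tightness from asymptotic tightness up to thickenings -/

section Tight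

variable {X : Type*} [MetricSpace X] [MeasurableSpace X] [BorelSpace X] [SecondCountableTopology X]
  [CompleteSpace X]

/-- **One scale of Lemma 2.4 (e), for all `n`**: if a compact `K` has `α_n(X ∖ B(K, η)) ≤ η` for
all large `n`, then some compact `K'` has `α_n(X ∖ B(K', η)) ≤ η` for *all* `n` — add compact
sets carrying all but `η` of the mass of the finitely many remaining measures (finite measures on
a Polish space are tight, `isTightMeasureSet_singleton`). [cite: Bamler2023, §2.1, Lemma 2.4 (e)] -/
theorem exists_isCompact_forall_measure_compl_thickening_le_of_eventually
    {α : ℕ → Measure X} [∀ n, IsFiniteMeasure (α n)] {η : ℝ≥0} (hη : 0 < η)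
    (h : ∃ K : Set X, IsCompact K ∧ ∀ᶠ n in atTop, α n (thickening (η : ℝ) K)ᶜ ≤ η) :
    ∃ K : Set X, IsCompact K ∧ ∀ n, α n (thickening (η : ℝ) K)ᶜ ≤ η := by
  obtain ⟨K, hK, hev⟩ := h
  obtain ⟨N, hN⟩ := eventually_atTop.1 hev
  have hj : ∀ j, ∃ K : Set X, IsCompact K ∧ α j Kᶜ ≤ η := fun j ↦ by
    obtain ⟨K, hK, h⟩ := isTightMeasureSet_iff_exists_isCompact_measure_compl_le.1
      (isTightMeasureSet_singleton (μ := α j)) η (by exact_mod_cast hη)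
    exact ⟨K, hK, h _ rfl⟩
  choose Kj hKj hKjle using hj
  refine ⟨K ∪ ⋃ j ∈ Finset.range N, Kj j,
    hK.union ((Finset.range N).isCompact_biUnion fun j _ ↦ hKj j), fun n ↦ ?_⟩
  rcases lt_or_ge n N with hn | hn
  · have hsub : Kj n ⊆ thickening (η : ℝ) (K ∪ ⋃ j ∈ Finset.range N, Kj j) :=
      ((subset_biUnion_of_mem (u := fun j ↦ Kj j) (Finset.mem_range.2 hn)).trans
        subset_union_right).trans (self_subset_thickening (by exact_mod_cast hη) _)
    exact (measure_mono (compl_subset_compl.2 hsub)).trans (hKjle n)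
  · exact (measure_mono (compl_subset_compl.2
      (thickening_subset_of_subset _ subset_union_left))).trans (hN n hn)

/-- **Bamler 2023, Lemma 2.4 (e)** (*"A sequence `μ_i ∈ 𝒫(X)` is tight if and only if for any
`ε > 0` there is a compact subset `K'_ε ⊂ X` such that `μ_i(X ∖ B(K'_ε, ε)) ≤ ε` for large
`i`"*, the nontrivial direction, for finite measures on a complete separable metric space): with
`Σ_m η_m ≤ ε` and compact `K_m` such that `α_n(X ∖ B(K_m, η_m)) ≤ η_m` for all `n`
(`exists_isCompact_forall_measure_compl_thickening_le_of_eventually`), the set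
`A := ⋂_m B̄(K_m, η_m)` is closed and totally bounded, hence compact, and
`α_n(X ∖ A) ≤ Σ_m η_m ≤ ε`. [cite: Bamler2023, §2.1, Lemma 2.4 (e)] -/
theorem isTightMeasureSet_range_of_forall_eventually_thickening
    {α : ℕ → Measure X} [∀ n, IsFiniteMeasure (α n)]
    (h : ∀ η : ℝ≥0, 0 < η → ∃ K : Set X, IsCompact K ∧
      ∀ᶠ n in atTop, α n (thickening (η : ℝ) K)ᶜ ≤ η) :
    IsTightMeasureSet (range α) := by
  -- adapted from `isTightMeasureSet_range_of_wassersteinW1_cauchySeq` (WassersteinW1Complete)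
  rw [isTightMeasureSet_iff_exists_isCompact_measure_compl_le]
  intro ε hε
  obtain ⟨ε', hε'pos, hsum⟩ := ENNReal.exists_pos_sum_of_countable hε.ne' ℕ
  choose K hK hKle using fun m ↦
    exists_isCompact_forall_measure_compl_thickening_le_of_eventually (hε'pos m) (h _ (hε'pos m))
  set A : Set X := ⋂ m, cthickening (ε' m : ℝ) (K m) with hA
  have hclosed : IsClosed A := isClosed_iInter fun m ↦ isClosed_cthickening
  -- the radii tend to zero
  have hsum' : Summable ε' := by
    rw [← ENNReal.tsum_coe_ne_top_iff_summable]
    exact (hsum.trans_le le_top).ne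
  have ht0 : Tendsto (fun m ↦ (ε' m : ℝ)) atTop (𝓝 0) := by
    have h := (NNReal.summable_coe.2 hsum').tendsto_atTop_zero
    exact h
  refine ⟨A, ?_, ?_⟩
  · -- `A` is compact: closed and totally bounded in a complete space
    refine isCompact_iff_totallyBounded_isComplete.2 ⟨?_, hclosed.isComplete⟩
    refine Metric.totallyBounded_iff.2 fun δ hδ ↦ ?_
    obtain ⟨m, hm⟩ := (ht0.eventually (gt_mem_nhds (by positivity : (0 : ℝ) < δ / 4))).exists
    obtain ⟨t, htfin, hcover⟩ :=
      Metric.totallyBounded_iff.1 (hK m).totallyBounded (δ / 4) (by positivity)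
    refine ⟨t, htfin, fun x hx ↦ ?_⟩
    have hxm : x ∈ cthickening (ε' m : ℝ) (K m) := mem_iInter.1 hx m
    rcases (K m).eq_empty_or_nonempty with hKe | hKne
    · rw [hKe, cthickening_empty] at hxm
      exact hxm.elim
    obtain ⟨z, hz, hxz⟩ := (hK m).exists_infEDist_eq_edist hKne x
    have hdxz : dist x z ≤ ε' m := by
      rw [← edist_le_ofReal (NNReal.coe_nonneg _), ← hxz]
      exact mem_cthickening_iff.1 hxm
    obtain ⟨y, hy, hzy⟩ := mem_iUnion₂.1 (hcover hz)
    refine mem_iUnion₂.2 ⟨y, hy, ?_⟩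
    rw [mem_ball] at hzy ⊢
    calc dist x y ≤ dist x z + dist z y := dist_triangle _ _ _
      _ < δ / 4 + δ / 4 := add_lt_add (hdxz.trans_lt hm) hzy
      _ < δ := by linarith
  · -- mass bound
    rintro _ ⟨k, rfl⟩
    calc α k Aᶜ = α k (⋃ m, (cthickening (ε' m : ℝ) (K m))ᶜ) := by rw [hA, compl_iInter]
      _ ≤ ∑' m, α k (cthickening (ε' m : ℝ) (K m))ᶜ := measure_iUnion_le _
      _ ≤ ∑' m, α k (thickening (ε' m : ℝ) (K m))ᶜ := ENNReal.tsum_le_tsum fun m ↦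
          measure_mono (compl_subset_compl.2 (thickening_subset_cthickening _ _))
      _ ≤ ∑' m, (ε' m : ℝ≥0∞) := ENNReal.tsum_le_tsum fun m ↦ hKle m k
      _ ≤ ε := hsum.le

end Tight

/-! ### The key step: the gradient property spreads kernel mass over a ball of base points -/

section GradientProperty

variable {Xk Xl : Type*} [MetricSpace Xk] [MeasurableSpace Xk] [OpensMeasurableSpace Xk]
  [MeasurableSpace Xl]

/-- **Key step of Bamler's Claim (arXiv v1 Claim 162)**: let `κ` be a probability kernel from
`X_k` to `X_l` with the gradient property at `T = 0` and constant `L` (*"by Definition 3.2 (6)"*: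
for every measurable `v : X_l → [0, 1]`, `x ↦ ∫ v dκ_x` is constant or of the form `Φ ∘ f` with
`f` `L`-Lipschitz), and let `μ_l = ∫ κ_x dμ_k(x)` (conjugate heat flow). If `κ_{x₀}(S) > ε`
(`0 < ε < 1`) and `μ_k(B(x₀, D)) ≥ p`, then **`μ_l(S) ≥ min(ε, Φ(Φ⁻¹(ε) − L D) · p)`** — in the
Lipschitz case `Φ(f(x₀)) = κ_{x₀}(S) > ε` forces `f(x₀) > Φ⁻¹(ε)`, so `κ_x(S) = Φ(f(x)) ≥
Φ(Φ⁻¹(ε) − L D)` on `B(x₀, D)` and `μ_l(S) = ∫ κ_x(S) dμ_k(x) ≥ Φ(Φ⁻¹(ε) − L D) μ_k(B(x₀, D))`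
(*"we would have `ν_{·;t_l}(𝒳_{t_l} ∖ K_{i,ε}) ≥ …` on `B(xⁱ, D)`, which would imply
`μ_{t_l}(𝒳_{t_l} ∖ K_{i,ε}) = ∫ ν_{y;t_l}(𝒳_{t_l} ∖ K_{i,ε}) dμ_{t_k}(y) ≥ ½ Φ(…)`"*); in the
constant case `μ_l(S) = κ_{x₀}(S) > ε`.
[cite: Bamler2023, §7.3, proof of the Claim (arXiv v1 Claim 162)] -/
theorem measure_le_of_gradient_property
    (κ : Xk → Measure Xl) [∀ x, IsProbabilityMeasure (κ x)] {L : ℝ≥0}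
    (hgrad : ∀ (v : Xl → ℝ), Measurable v → (∀ y, v y ∈ Icc (0 : ℝ) 1) →
      (∃ c, ∀ x, ∫ y, v y ∂κ x = c) ∨
        ∃ f : Xk → ℝ, LipschitzWith L f ∧ ∀ x, ∫ y, v y ∂κ x = MetricFlow.Phi (f x))
    (μk : Measure Xk) [IsProbabilityMeasure μk] (μl : Measure Xl)
    (hchf : ∀ (g : Xl → ℝ≥0∞), Measurable g → ∫⁻ y, g y ∂μl = ∫⁻ x, ∫⁻ y, g y ∂κ x ∂μk)
    {S : Set Xl} (hS : MeasurableSet S) {x₀ : Xk} {D ε : ℝ} {p : ℝ≥0∞} (hε0 : 0 < ε)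
    (hε1 : ε < 1) (hmass : p ≤ μk (ball x₀ D)) (hlt : ENNReal.ofReal ε < κ x₀ S) :
    min (ENNReal.ofReal ε) (ENNReal.ofReal (MetricFlow.Phi (MetricFlow.PhiInv ε - L * D)) * p) ≤
      μl S := by
  -- `μ_l(S) = ∫ κ_x(S) dμ_k(x)` and `∫ 1_S dκ_x = κ_x(S)`
  have hμl : μl S = ∫⁻ x, κ x S ∂μk := by
    have h := hchf (S.indicator 1) (measurable_one.indicator hS)
    simp only [lintegral_indicator_one hS] at h
    exact h
  have hv : ∀ x, ∫ y, S.indicator (1 : Xl → ℝ) y ∂κ x = (κ x).real S := fun x ↦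
    integral_indicator_one hS
  have hv01 : ∀ y, S.indicator (1 : Xl → ℝ) y ∈ Icc (0 : ℝ) 1 := fun y ↦
    ⟨Set.indicator_nonneg (fun _ _ ↦ zero_le_one) y,
      Set.indicator_apply_le' (fun _ ↦ le_rfl) fun _ ↦ zero_le_one⟩
  have hreal : ∀ x, κ x S = ENNReal.ofReal ((κ x).real S) := fun x ↦
    (ofReal_measureReal (measure_ne_top _ _)).symm
  have hε' : ε < (κ x₀).real S :=
    (ENNReal.ofReal_lt_iff_lt_toReal hε0.le (measure_ne_top _ _)).1 hlt
  rcases hgrad _ (measurable_one.indicator hS) hv01 with ⟨c, hc⟩ | ⟨f, hf, hfx⟩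
  · -- constant case: `κ_x(S) = κ_{x₀}(S)` for all `x`, so `μ_l(S) = κ_{x₀}(S) > ε`
    have hcx : ∀ x, κ x S = κ x₀ S := fun x ↦ by
      rw [hreal x, hreal x₀, ← hv x, ← hv x₀, hc x, hc x₀]
    refine (min_le_left _ _).trans (hlt.le.trans_eq ?_)
    rw [hμl]
    simp only [hcx]
    rw [lintegral_const, measure_univ, mul_one]
  · -- Lipschitz case
    have hx₀ : MetricFlow.PhiInv ε < f x₀ := by
      rw [← MetricFlow.Phi_strictMono.lt_iff_lt, MetricFlow.Phi_PhiInv hε0 hε1, ← hfx x₀, hv x₀]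
      exact hε'
    have hball : ∀ x ∈ ball x₀ D,
        ENNReal.ofReal (MetricFlow.Phi (MetricFlow.PhiInv ε - L * D)) ≤ κ x S := fun x hx ↦ by
      rw [hreal x, ← hv x, hfx x]
      refine ENNReal.ofReal_le_ofReal (MetricFlow.Phi_strictMono.monotone ?_)
      have h1 := hf.dist_le_mul x x₀
      rw [Real.dist_eq] at h1
      have h2 : (L : ℝ) * dist x x₀ ≤ L * D :=
        mul_le_mul_of_nonneg_left (le_of_lt (mem_ball.1 hx)) L.coe_nonneg
      linarith [(abs_le.1 (h1.trans h2)).1]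
    refine (min_le_right _ _).trans ?_
    calc ENNReal.ofReal (MetricFlow.Phi (MetricFlow.PhiInv ε - L * D)) * p
        ≤ ENNReal.ofReal (MetricFlow.Phi (MetricFlow.PhiInv ε - L * D)) * μk (ball x₀ D) := by
          gcongr
      _ = ∫⁻ _ in ball x₀ D, ENNReal.ofReal (MetricFlow.Phi (MetricFlow.PhiInv ε - L * D)) ∂μk :=
          (setLIntegral_const _ _).symm
      _ ≤ ∫⁻ x in ball x₀ D, κ x S ∂μk := setLIntegral_mono' measurableSet_ball hball
      _ ≤ ∫⁻ x, κ x S ∂μk := setLIntegral_le_lintegral _ _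
      _ = μl S := hμl.symm

end GradientProperty

/-! ### Second moments from variances -/

section Moments

variable {X : Type*} [MetricSpace X] [MeasurableSpace X]

omit [MeasurableSpace X] in
/-- `d(x, z)² ≤ 2 d(x, y)² + 2 d(y, z)²`, read in `[0, ∞]`. [folklore] -/
private theorem edist_sq_le_two_mul_add (x y z : X) :
    edist x z ^ 2 ≤ 2 * edist x y ^ 2 + 2 * edist y z ^ 2 := by
  have h : dist x z ^ 2 ≤ 2 * dist x y ^ 2 + 2 * dist y z ^ 2 := by
    nlinarith [mul_nonneg (sub_nonneg.2 (dist_triangle x y z))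
      (by positivity : 0 ≤ dist x y + dist y z + dist x z), sq_nonneg (dist x y - dist y z)]
  have e : ∀ a b : X, edist a b ^ 2 = ENNReal.ofReal (dist a b ^ 2) := fun a b ↦ by
    rw [edist_dist, ENNReal.ofReal_pow dist_nonneg]
  calc edist x z ^ 2 = ENNReal.ofReal (dist x z ^ 2) := e x z
    _ ≤ ENNReal.ofReal (2 * dist x y ^ 2 + 2 * dist y z ^ 2) := ENNReal.ofReal_le_ofReal h
    _ = 2 * edist x y ^ 2 + 2 * edist y z ^ 2 := by
        rw [ENNReal.ofReal_add (by positivity) (by positivity), ENNReal.ofReal_mul zero_le_two,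
          ENNReal.ofReal_mul zero_le_two, ENNReal.ofReal_ofNat, e x y, e y z]

/-- **Second moments from the variance and a massive bounded set**: for a probability measure
`α` with `Var(α) = ∫∫ d² dα dα ≤ W` and a measurable `B ⊆ B̄(z₀, R)` with `α(B) ≥ ½`,
`∫ d(z₀, ·)² dα ≤ 4R² + 4W` — integrate `∫ d(z₀, ·)² dα ≤ 2 d(z₀, y)² + 2 ∫ d(y, ·)² dα` over
`y ∈ B`: `α(B) ∫ d(z₀, ·)² dα ≤ 2R² + 2 Var(α)`. [folklore] -/
theorem lintegral_edist_sq_le_of_variance_le (α : Measure X) [IsProbabilityMeasure α] {W : ℝ}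
    (hW0 : 0 ≤ W) (hW : variance α α ≤ ENNReal.ofReal W) {B : Set X} (hBm : MeasurableSet B)
    (hB : 2⁻¹ ≤ α B) (z₀ : X) {R : ℝ} (hR : ∀ y ∈ B, dist y z₀ ≤ R) :
    ∫⁻ z, edist z₀ z ^ 2 ∂α ≤ ENNReal.ofReal (4 * R ^ 2 + 4 * W) := by
  set M : ℝ≥0∞ := ∫⁻ z, edist z₀ z ^ 2 ∂α with hM
  -- pointwise in the auxiliary point `y`
  have hpt : ∀ y, M ≤ 2 * edist z₀ y ^ 2 + 2 * ∫⁻ z, edist y z ^ 2 ∂α := fun y ↦ by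
    calc M ≤ ∫⁻ z, 2 * edist z₀ y ^ 2 + 2 * edist y z ^ 2 ∂α :=
          lintegral_mono fun z ↦ edist_sq_le_two_mul_add z₀ y z
      _ = 2 * edist z₀ y ^ 2 + 2 * ∫⁻ z, edist y z ^ 2 ∂α := by
          rw [lintegral_add_left (measurable_const (a := 2 * edist z₀ y ^ 2)), lintegral_const,
            measure_univ, mul_one, lintegral_const_mul' _ _ ENNReal.ofNat_ne_top]
  have hRB : ∀ y ∈ B, edist z₀ y ^ 2 ≤ ENNReal.ofReal (R ^ 2) := fun y hy ↦ by
    rw [edist_dist, ← ENNReal.ofReal_pow dist_nonneg, dist_comm]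
    exact ENNReal.ofReal_le_ofReal (pow_le_pow_left₀ dist_nonneg (hR y hy) 2)
  -- integrate over `y ∈ B`
  have hint : M * α B ≤ 2 * ENNReal.ofReal (R ^ 2) + 2 * ENNReal.ofReal W := by
    calc M * α B = ∫⁻ _ in B, M ∂α := (setLIntegral_const _ _).symm
      _ ≤ ∫⁻ y in B, 2 * ENNReal.ofReal (R ^ 2) + 2 * ∫⁻ z, edist y z ^ 2 ∂α ∂α :=
          setLIntegral_mono' hBm fun y hy ↦ (hpt y).trans (by gcongr; exact hRB y hy)
      _ ≤ ∫⁻ y, 2 * ENNReal.ofReal (R ^ 2) + 2 * ∫⁻ z, edist y z ^ 2 ∂α ∂α :=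
          setLIntegral_le_lintegral _ _
      _ = 2 * ENNReal.ofReal (R ^ 2) + 2 * variance α α := by
          rw [lintegral_add_left (measurable_const (a := 2 * ENNReal.ofReal (R ^ 2))),
            lintegral_const, measure_univ, mul_one, lintegral_const_mul' _ _ ENNReal.ofNat_ne_top,
            variance_def]
      _ ≤ 2 * ENNReal.ofReal (R ^ 2) + 2 * ENNReal.ofReal W := by gcongr
  -- conclude with `α(B) ≥ ½`
  calc M = 2 * (M * 2⁻¹) := by
        rw [mul_comm M 2⁻¹, ← mul_assoc, ENNReal.mul_inv_cancel two_ne_zero ENNReal.ofNat_ne_top,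
          one_mul]
    _ ≤ 2 * (M * α B) := by gcongr
    _ ≤ 2 * (2 * ENNReal.ofReal (R ^ 2) + 2 * ENNReal.ofReal W) := by gcongr
    _ = ENNReal.ofReal (4 * R ^ 2 + 4 * W) := by
        rw [ENNReal.ofReal_add (by positivity) (by positivity),
          ENNReal.ofReal_mul (by norm_num : (0 : ℝ) ≤ 4),
          ENNReal.ofReal_mul (by norm_num : (0 : ℝ) ≤ 4)]
        simp only [ENNReal.ofReal_ofNat]
        ring

/-- **`Var(φ_* μ) ≤ Var(μ)` for an isometric embedding `φ`** (in fact equality; push-forward of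
the double integral, `lintegral_map_le` twice and `d(φ x₁, φ x₂) = d(x₁, x₂)`). [folklore] -/
theorem variance_map_le {Z : Type*} [MetricSpace Z] [MeasurableSpace Z] {φ : X → Z}
    (hφ : Isometry φ) (μ : Measure X) : variance (μ.map φ) (μ.map φ) ≤ variance μ μ := by
  rw [variance_def, variance_def]
  calc ∫⁻ z₁, ∫⁻ z₂, edist z₁ z₂ ^ 2 ∂μ.map φ ∂μ.map φ
      ≤ ∫⁻ x₁, ∫⁻ z₂, edist (φ x₁) z₂ ^ 2 ∂μ.map φ ∂μ :=
        lintegral_map_le (fun z₁ ↦ ∫⁻ z₂, edist z₁ z₂ ^ 2 ∂μ.map φ) φ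
    _ ≤ ∫⁻ x₁, ∫⁻ x₂, edist (φ x₁) (φ x₂) ^ 2 ∂μ ∂μ :=
        lintegral_mono fun x₁ ↦ lintegral_map_le (fun z₂ ↦ edist (φ x₁) z₂ ^ 2) φ
    _ = ∫⁻ x₁, ∫⁻ x₂, edist x₁ x₂ ^ 2 ∂μ ∂μ := by simp only [hφ.edist_eq]

end Moments

end Literature.Geometry.Riemannian

end
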